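import Summits.BirchSwinnertonDyer.Rank1Residual.Additive.XSplitMultRankZeroCyclotomicThreeX4Facts
import Summits.BirchSwinnertonDyer.Rank1Residual.Additive.XSplitMultRankZeroCyclotomicThreeNoMilneFacts
import HarnessLib

/-!
# Line V16, X4 side at Facts level (`p = 3`, `K = ℚ(ζ₃)`, ranks `(0,0)`, split multiplicative twist with big image) — Milne's A73 PROVED AWAY
# (cell `b2b-bsdres`, team n1011, seat p16 GEN 11; lead R5-87 (e) (W2) = additive-p4 GEN 23 word: the
# UPPER / two-sided no-Milne twins of the additive-p4 ℚ(ζ₃) lines are the p16 lineage's; row T-MIL-CAN)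

HONEST FRAMING (cell `b2b-bsdres`, run/shared/lean/b2b/bsd-rank1-residual/, verbatim in every
file): the goal of the cell is to DELETE the COMBINATION-SHAPED residual classes of the
Birch–Swinnerton-Dyer formula for ALL analytic-rank `≤ 1` elliptic curves over `ℚ` — "full BSD
formula for every rank `≤ 1` curve in class `C`" assembled STRICTLY from published theorems — so
that the rank-`≤ 1` remainder becomes exactly the CONSTRUCTION-SHAPED classes, which are TYPED
(missing-input `Prop`s), NOT attempted. This is not "finishing BSD". Team n1011 (N10 / N11), seat p16:
research route; X1 / X3 / X4 / X10 / N10 / N11 labels and marks UNCHANGED; nothing booked. Theorems only.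

This file is `XSplitMultRankZeroCyclotomicThreeX4Facts.lean` (mathematics, census and references in THAT file's docstrings,
unchanged) with the Milne binder `hMilne : Milne1972.bsdQuotient_baseChange_quadratic_anyModel` (A73)
DELETED from every Milne-binding theorem and NOTHING added: each such theorem is re-issued under its name
with the suffix `_noMilne`, every other binder and every proof line byte-identical, every call to a
Milne-binding tree theorem redirected to its no-Milne twin (`…_noLocal` cores / `…_noMilne` Facts of the
p16 lineage); Milne-free helpers of the source file are used as landed, not re-declared. What the
additive-p4 cores read from A73 — `Ш(V_K)` finite and the `3`-adic valuation of the card identity over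
`K = ℚ(ζ₃)` — are the THEOREMS `shaFinite_baseChange_of_twist` and T-MIL-CAN FILE 4
`padicVal_card_identity_baseChange[_anyRank]_of_natAbs_discr_eq` (`|d_K| = 3`, `V` good or multiplicative
at `3`: the per-place fibre identities (T) at EVERY place — n1011-p01's T-MIL-3 H-5a with rows T-MIL-B2 /
T-A233 inside). Every other displayed hypothesis (named facts, (⊇/K) where present, census bits,
certificates) is exactly the source file's. Labels UNCHANGED; nothing booked; no mark moves.
-/

noncomputable section

open scoped Classical MatrixGroups ModularForm

open CongruenceSubgroup WeierstrassCurve NumberField IsDedekindDomain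
  Literature.NumberTheory.EllipticCurves Literature.NumberTheory.EllipticCurves.ModularForms
  Literature.NumberTheory.EllipticCurves.Rank1Residual
  Literature.NumberTheory.EllipticCurves.Rank1Residual.Typed
  Literature.NumberTheory.GaloisRepresentations

namespace Summit.BirchSwinnertonDyer.Rank1Residual.Additive

/-! ## §4 X4: `ρ_{V,3^∞}` onto — Kato's theorem (Wuthrich Thm. 3 / Cor. 19, factor `I`) at the split prime, over `ℚ(ζ₃)` -/

section X4Facts

variable (V : WeierstrassCurve ℚ) [V.IsElliptic] [V.IsGloballyMinimal]
  (W : WeierstrassCurve ℚ) [W.IsElliptic] [W.IsGloballyMinimal]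

/-- **Line V16 (X4 (M)-rows, `V` split, `p = 3`), core inequality, from named facts only.** Let `V/ℚ` be
globally minimal with SPLIT multiplicative reduction at `3` and `ρ̄_{V,3ⁿ}` onto for every `n`,
`W = C • V^{(−3)}` globally minimal and ADDITIVE at `3`, both of analytic rank `0`. Then
`ord₃ #Ш(V) + ord₃ #Ш(W) ≤ ord₃ #Ш_an(V) + ord₃ #Ш_an(W)`, granted EXACTLY: Kato's divisibility as
attributed by Wuthrich 2014 Thm. 3 / Cor. 19 (split multiplicative `3`, factor `I`, over `ℚ(ζ₃)`; named fact `hKato`), Greenberg LNM 1716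
pp. 112–113 at a split prime (`hGr`), Greenberg–Stevens (`hGS`), modularity, GZK.
[cite: Wuthrich2014, Thm. 3 (p. 383) and Cor. 19 (pp. 398–399)] [cite: GreenbergLNM1716, §4 pp. 112–113]
[cite: Kobayashi2006DocMath, Cor. 4.2 (p. 575)] [cite: Milne1972ArithmeticAV, §1 Thm. 1 and §2 (through DokchitserDokchitserAnnals2010, §2.1, proof of Thm. 8)] -/
theorem XSplitMultCyclotomicThree.exists_padicVal_shaOrder_add_le_of_facts_of_surj_pow_noMilne
    (hKato : Wuthrich2014.kato_charIdeal_dvd_splitMultiplicative_cyclotomicThree_of_surjective)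
    (hGr : Greenberg1999.thm41Analogue_charValue_rankZero_split_baseChange)
    (hGS : greenberg_stevens V 3)
    (hGZK : rank_eq_analyticRank_of_analyticRank_le_one) (hmod : hasEntireLFunction_rat)
    (hmodD : nonempty_modularParametrizationData)
    (C : VariableChange ℚ) (hC : C • V.quadraticTwist (-(3 : ℚ)) = W)
    (hsplit : V.HasSplitMultiplicativeReductionAtPrime 3)
    (hsurj : ∀ n : ℕ, V.HasSurjectiveModNGaloisRep (3 ^ n : ℕ)) (hadd : Addv W 3)
    (hrV : V.analyticRank = 0) (hrW : W.analyticRank = 0) :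
    ∃ qV qW : ℚ, shaAn V = (qV : ℂ) ∧ shaAn W = (qW : ℂ) ∧
      (padicValNat 3 V.shaOrder : ℤ) + padicValNat 3 W.shaOrder ≤ padicValRat 3 qV + padicValRat 3 qW := by
  haveI : IsCyclotomicExtension {3} ℚ (CyclotomicField 3 ℚ) := CyclotomicField.isCyclotomicExtension 3 ℚ
  set K := CyclotomicField 3 ℚ
  obtain ⟨Dq⟩ := (nonempty_tateParameterData_iff_holds (W := V) (p := 3)).mpr hsplit
  have hLinv : LInvariant Dq ≠ 0 := LInvariant_ne_zero_holds (W := V) (p := 3) Dq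
  haveI : NeZero (V.conductorNorm ℤ) := ⟨(V.conductorNorm_pos_holds).ne'⟩
  obtain ⟨Dm⟩ := hmodD V
  have hf : IsNewformOf V Dm.f := Dm.isNewformOf
  obtain ⟨ϖ, -, hϖ, -⟩ := Dm.exists_rat_mul_realPeriodRat_eq_plusPeriod
  obtain ⟨ϖ', -, hϖ'⟩ := exists_rat_mul_imaginaryPeriodRat_eq_minusPeriod Dm
  obtain ⟨Lp, hLp⟩ := exists_isSplitMultPAdicLFunctionOf hsplit hf
  obtain ⟨hLp0, hLp1⟩ := constantCoeff_and_coeff_one_of_greenbergStevens hGS Dq hf hLp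
  have hLm0 := constantCoeff_padicLFunctionMinusBranchMult_one_three_of_split V hsplit hf
  refine XSplitMultCyclotomicThree.exists_padicVal_shaOrder_add_le_noLocal K V W hGZK hmod C hC Dq hLinv
    hadd hrV hrW hf ϖ ϖ' hϖ hϖ' Lp (padicLFunctionMinusBranchMult Dm.f (1 : ℚ_[3]) 1) 1 1 hLp0 hLp1 hLm0
    (fun κ γ hκ hγ hγ' D ↦ ?_) (XSplitMultCyclotomicThree.greenbergK_of_fact K V hGr Dq)
  exact hKato V K (V.baseChange K) hsplit hsurj ⟨1, one_smul _ _⟩ hκ hγ hγ' hf D ϖ ϖ' hϖ hϖ' Lp hLp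

/-- **Line V16 (X4) with the image hypothesis as CENSUS BITS of `W`**: `surj(3)` (`ρ̄_{W,3}` onto) and
`ram(3)` (a multiplicative prime `ℓ ≠ 3` of `W` with `3 ∤ v_ℓ(Δ_min)`) give `ρ̄_{V,3ⁿ}` onto for all
`n` (`forall_surj_pow_of_twist_pStar_of_surj_of_ram`, gen 3); hence the core inequality on X4 ∧ (M) ∧
`V` split ∧ `p = 3` ∧ ranks `(0,0)` ∧ `surj(3) ∧ ram(3)`, from named facts only. [cite: Wuthrich2014, Thm. 3 (p. 383) and Cor. 19 (pp. 398–399)]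
[cite: GreenbergLNM1716, §4 pp. 112–113] -/
theorem XSplitMultCyclotomicThree.exists_padicVal_shaOrder_add_le_of_facts_of_surj_of_ram_noMilne
    (hKato : Wuthrich2014.kato_charIdeal_dvd_splitMultiplicative_cyclotomicThree_of_surjective)
    (hGr : Greenberg1999.thm41Analogue_charValue_rankZero_split_baseChange)
    (hGS : greenberg_stevens V 3)
    (hGZK : rank_eq_analyticRank_of_analyticRank_le_one) (hmod : hasEntireLFunction_rat)
    (hmodD : nonempty_modularParametrizationData)
    (C : VariableChange ℚ) (hC : C • V.quadraticTwist (-(3 : ℚ)) = W)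
    (hsplit : V.HasSplitMultiplicativeReductionAtPrime 3)
    (hsurj : Surj W 3) (hram : Ram W 3) (hadd : Addv W 3)
    (hrV : V.analyticRank = 0) (hrW : W.analyticRank = 0) :
    ∃ qV qW : ℚ, shaAn V = (qV : ℂ) ∧ shaAn W = (qW : ℂ) ∧
      (padicValNat 3 V.shaOrder : ℤ) + padicValNat 3 W.shaOrder ≤ padicValRat 3 qV + padicValRat 3 qW := by
  have hC' : C • V.quadraticTwist (((-((3 : ℕ) : ℤ)) : ℤ) : ℚ) = W := by push_cast; exact hC
  exact XSplitMultCyclotomicThree.exists_padicVal_shaOrder_add_le_of_facts_of_surj_pow_noMilne V W hKato hGr hGS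
    hGZK hmod hmodD C hC hsplit
    (forall_surj_pow_of_twist_pStar_of_surj_of_ram 3 V (k := -1) (by norm_num) (Or.inr rfl) C hC'
      hsurj hram) hadd hrV hrW

/-- **The cell's typed UPPER half for the additive X4 (M)-curve, from named facts only** (`V` split at
`3`, `surj(3) ∧ ram(3)` on `W`, ranks `(0,0)`): if `#Ш_an(V)` has non-positive `3`-adic valuation
then `Typed.MissingUpperBoundAt W 3`. [cite: Wuthrich2014, Thm. 3 (p. 383) and Cor. 19 (pp. 398–399)]
[cite: GreenbergLNM1716, §4 pp. 112–113] -/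
theorem XSplitMultCyclotomicThree.missingUpperBoundAt_of_facts_of_surj_of_ram_noMilne
    (hKato : Wuthrich2014.kato_charIdeal_dvd_splitMultiplicative_cyclotomicThree_of_surjective)
    (hGr : Greenberg1999.thm41Analogue_charValue_rankZero_split_baseChange)
    (hGS : greenberg_stevens V 3)
    (hGZK : rank_eq_analyticRank_of_analyticRank_le_one) (hmod : hasEntireLFunction_rat)
    (hmodD : nonempty_modularParametrizationData)
    (C : VariableChange ℚ) (hC : C • V.quadraticTwist (-(3 : ℚ)) = W)
    (hsplit : V.HasSplitMultiplicativeReductionAtPrime 3)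
    (hsurj : Surj W 3) (hram : Ram W 3) (hadd : Addv W 3)
    (hrV : V.analyticRank = 0) (hrW : W.analyticRank = 0)
    {qV : ℚ} (hqV : shaAn V = (qV : ℂ)) (hv : padicValRat 3 qV ≤ 0) :
    MissingUpperBoundAt W 3 := by
  obtain ⟨qV', qW, hqV', hqW, hle⟩ :=
    XSplitMultCyclotomicThree.exists_padicVal_shaOrder_add_le_of_facts_of_surj_of_ram_noMilne V W hKato hGr hGS
      hGZK hmod hmodD C hC hsplit hsurj hram hadd hrV hrW
  have hqq : qV' = qV := by exact_mod_cast hqV'.symm.trans hqV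
  subst hqq
  refine ⟨qW, hqW, ?_⟩
  have h0 : (0 : ℤ) ≤ padicValNat 3 V.shaOrder := by positivity
  linarith

/-- **`BSD(W,3) ∧ BSD(V,3)` on the doubly-unit X4 (M)-rows, from named facts only**: `V` split
multiplicative at `3`, `surj(3) ∧ ram(3)` on `W`, ranks `(0,0)`, `#Ш_an(V)` and `#Ш_an(W)` `3`-adic units
⇒ Miller's `BSD(W,3)` and `BSD(V,3)` — for the ADDITIVE X4 pair `(W,3)` (type `I_n*`, `W[3]` irreducible,
`v₃(j) < 0`) and its split multiplicative big-image twist pair `(V,3)` (an X11-type pair)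
simultaneously. Census (engine A, `N < 2·10⁴`): 202 CORE-open rank-`(0,0)` X4 ∧ (M) ∧ split rows.
Labels UNCHANGED; nothing booked by this theorem.
[cite: Wuthrich2014, Thm. 3 (p. 383) and Cor. 19 (pp. 398–399)] [cite: GreenbergLNM1716, §4 pp. 112–113]
[cite: Milne1972ArithmeticAV, §1 Thm. 1 and §2 (through DokchitserDokchitserAnnals2010, §2.1, proof of Thm. 8)] -/
theorem XSplitMultCyclotomicThree.bsdp_of_shaAn_units_of_facts_of_surj_of_ram_noMilne
    (hKato : Wuthrich2014.kato_charIdeal_dvd_splitMultiplicative_cyclotomicThree_of_surjective)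
    (hGr : Greenberg1999.thm41Analogue_charValue_rankZero_split_baseChange)
    (hGS : greenberg_stevens V 3)
    (hGZK : rank_eq_analyticRank_of_analyticRank_le_one) (hmod : hasEntireLFunction_rat)
    (hmodD : nonempty_modularParametrizationData)
    (C : VariableChange ℚ) (hC : C • V.quadraticTwist (-(3 : ℚ)) = W)
    (hsplit : V.HasSplitMultiplicativeReductionAtPrime 3)
    (hsurj : Surj W 3) (hram : Ram W 3) (hadd : Addv W 3)
    (hrV : V.analyticRank = 0) (hrW : W.analyticRank = 0)
    {qV qW : ℚ} (hqV : shaAn V = (qV : ℂ)) (hqW : shaAn W = (qW : ℂ))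
    (hvV : padicValRat 3 qV = 0) (hvW : padicValRat 3 qW = 0) : BSDp W 3 ∧ BSDp V 3 := by
  obtain ⟨qV', qW', hqV', hqW', hle⟩ :=
    XSplitMultCyclotomicThree.exists_padicVal_shaOrder_add_le_of_facts_of_surj_of_ram_noMilne V W hKato hGr hGS
      hGZK hmod hmodD C hC hsplit hsurj hram hadd hrV hrW
  have hqq : qV' = qV := by exact_mod_cast hqV'.symm.trans hqV
  have hqq' : qW' = qW := by exact_mod_cast hqW'.symm.trans hqW
  subst hqq hqq'
  rw [hvV, hvW, add_zero] at hle
  have hV0 : (0 : ℤ) ≤ padicValNat 3 V.shaOrder := by positivity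
  have hW0 : (0 : ℤ) ≤ padicValNat 3 W.shaOrder := by positivity
  have huW : MissingUpperBoundAt W 3 := ⟨qW', hqW', by rw [hvW]; linarith⟩
  have huV : MissingUpperBoundAt V 3 := ⟨qV', hqV', by rw [hvV]; linarith⟩
  exact ⟨bsdp_of_missingPPartAt W 3 hGZK (by rw [hrW]; exact zero_le_one)
      (missingPPartAt_of_upper_of_shaAn_unit W 3 huW hqW' hvW),
    bsdp_of_missingPPartAt V 3 hGZK (by rw [hrV]; exact zero_le_one)
      (missingPPartAt_of_upper_of_shaAn_unit V 3 huV hqV' hvV)⟩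

/-- **The `3 ∣ #Ш_an(W)` rows (X4 ∧ (M) ∧ split, `surj ∧ ram`): `BSD(W,3)` from ONE finite
certificate, named facts otherwise** (upper half above + Cassels–Tate squareness; for `k = 1` the
certificate is `Ш(W)[3] ≠ 0`). [cite: Wuthrich2014, Thm. 3 (p. 383) and Cor. 19 (pp. 398–399)] [cite: SilvermanAEC2009, Thm. X.4.14]
[cite: Miller2011LMS, §1 and Def. 1.1] -/
theorem XSplitMultCyclotomicThree.bsdp_of_casselsTate_of_pow_dvd_of_facts_of_surj_of_ram_noMilne
    (hKato : Wuthrich2014.kato_charIdeal_dvd_splitMultiplicative_cyclotomicThree_of_surjective)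
    (hGr : Greenberg1999.thm41Analogue_charValue_rankZero_split_baseChange)
    (hGS : greenberg_stevens V 3)
    (hGZK : rank_eq_analyticRank_of_analyticRank_le_one) (hmod : hasEntireLFunction_rat)
    (hmodD : nonempty_modularParametrizationData) (hCT : exists_casselsTate_pairing (K := ℚ))
    (C : VariableChange ℚ) (hC : C • V.quadraticTwist (-(3 : ℚ)) = W)
    (hsplit : V.HasSplitMultiplicativeReductionAtPrime 3)
    (hsurj : Surj W 3) (hram : Ram W 3) (hadd : Addv W 3)
    (hrV : V.analyticRank = 0) (hrW : W.analyticRank = 0)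
    {qV : ℚ} (hqV : shaAn V = (qV : ℂ)) (hvV : padicValRat 3 qV ≤ 0)
    {q : ℚ} (hq : shaAn W = (q : ℂ)) {k : ℕ} (hv : padicValRat 3 q ≤ 2 * k)
    (hdvd : 3 ^ (2 * k - 1) ∣ W.shaOrder) : BSDp W 3 :=
  bsdp_of_missingPPartAt W 3 hGZK (by rw [hrW]; exact zero_le_one)
    (missingPPartAt_of_lower_of_upper W 3
      (missingLowerBoundAt_of_casselsTate_of_pow_dvd W 3 hCT (hGZK W (by rw [hrW]; exact zero_le_one)).2
        hq hv hdvd)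
      (XSplitMultCyclotomicThree.missingUpperBoundAt_of_facts_of_surj_of_ram_noMilne V W hKato hGr hGS hGZK hmod
        hmodD C hC hsplit hsurj hram hadd hrV hrW hqV hvV))

/-! ### The image hypothesis from `surj(3)` alone (Wuthrich Lemma 20: `V` is multiplicative at `3`) -/

/-- **Line V16 (X4), `BSD(W,3) ∧ BSD(V,3)` on the doubly-unit rows with the image hypothesis from
`surj(3)` ALONE** (Lemma 20 as the named fact `hL20`; `V` split multiplicative at `3`, ranks `(0,0)`).
[cite: Wuthrich2014, Thm. 3 (p. 383), Cor. 19 and Lemma 20 (pp. 398–399)] [cite: GreenbergLNM1716, §4 pp. 112–113]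
[cite: Kobayashi2006DocMath, Cor. 4.2 (p. 575)] -/
theorem XSplitMultCyclotomicThree.bsdp_of_shaAn_units_of_facts_of_surj_of_lemma20_noMilne
    (hKato : Wuthrich2014.kato_charIdeal_dvd_splitMultiplicative_cyclotomicThree_of_surjective)
    (hGr : Greenberg1999.thm41Analogue_charValue_rankZero_split_baseChange)
    (hGS : greenberg_stevens V 3)
    (hL20 : Wuthrich2014.lemma20_surjective_threeAdic_of_semistable)
    (hGZK : rank_eq_analyticRank_of_analyticRank_le_one) (hmod : hasEntireLFunction_rat)
    (hmodD : nonempty_modularParametrizationData)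
    (C : VariableChange ℚ) (hC : C • V.quadraticTwist (-(3 : ℚ)) = W)
    (hsplit : V.HasSplitMultiplicativeReductionAtPrime 3)
    (hsurj : Surj W 3) (hadd : Addv W 3) (hrV : V.analyticRank = 0) (hrW : W.analyticRank = 0)
    {qV qW : ℚ} (hqV : shaAn V = (qV : ℂ)) (hqW : shaAn W = (qW : ℂ))
    (hvV : padicValRat 3 qV = 0) (hvW : padicValRat 3 qW = 0) : BSDp W 3 ∧ BSDp V 3 := by
  obtain ⟨qV', qW', hqV', hqW', hle⟩ :=
    XSplitMultCyclotomicThree.exists_padicVal_shaOrder_add_le_of_facts_of_surj_pow_noMilne V W hKato hGr hGS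
      hGZK hmod hmodD C hC hsplit
      (forall_surj_pow_of_twist_of_surj_of_lemma20_split V W hL20 C hC hsplit hsurj) hadd hrV hrW
  have hqq : qV' = qV := by exact_mod_cast hqV'.symm.trans hqV
  have hqq' : qW' = qW := by exact_mod_cast hqW'.symm.trans hqW
  subst hqq hqq'
  rw [hvV, hvW, add_zero] at hle
  have hV0 : (0 : ℤ) ≤ padicValNat 3 V.shaOrder := by positivity
  have hW0 : (0 : ℤ) ≤ padicValNat 3 W.shaOrder := by positivity
  have huW : MissingUpperBoundAt W 3 := ⟨qW', hqW', by rw [hvW]; linarith⟩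
  have huV : MissingUpperBoundAt V 3 := ⟨qV', hqV', by rw [hvV]; linarith⟩
  exact ⟨bsdp_of_missingPPartAt W 3 hGZK (by rw [hrW]; exact zero_le_one)
      (missingPPartAt_of_upper_of_shaAn_unit W 3 huW hqW' hvW),
    bsdp_of_missingPPartAt V 3 hGZK (by rw [hrV]; exact zero_le_one)
      (missingPPartAt_of_upper_of_shaAn_unit V 3 huV hqV' hvV)⟩

end X4Facts

end Summit.BirchSwinnertonDyer.Rank1Residual.Additive

end
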